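import Literature.Barriers.CriticalPhenomena.PlaquetteWalkHoleRootCutMarkingDoors
import Literature.Barriers.CriticalPhenomena.PlaquetteWalkHoleRootCutMarkingEdges
import HarnessLib

/-!
# Barrier catalogue (SAWScalingLimit): THE NORTHERN TWINS of the third-side law's and the edge form's kills — `K_N2`/`rootNN`,
`K_N1`/`farNWN`, the northern pockets — by the row mirror

Leaf of `PlaquetteWalkHoleRootCutMarkingDoors` (third-side law: `K_S1` on the east wall + `holeS`/`rootSS` absent ⇒ under EMPTY;
`K_S2` + `pocketSW` with the column shut ⇒ under EMPTY) and `PlaquetteWalkHoleRootCutMarkingEdges` (edge form: `rootSS ∨ K_S1`,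
`farSWS ∨ K_S2` column kills). The reflection in the root row (`ΩG.mirrorFar`, `rowMirrorDom`, `kindsIn_eq_coCorner_of_mirrorFar_corner`,
`kindsIn_eq_corner_of_mirrorFar_coCorner`) turns each into a statement about OVER-walks (first side `N`):

§1 ★★★★★ `ΩG.WE_eq_excursionWinding_of_over_killNE_holeN_eastWall` / `…_killNE_rootNN_eastWall` — `K_N2 = killNE w` on the east wall and
`holeN = (w.1 − 1, w.2 + 1)` (resp. `rootNN = (w.1, w.2 + 2)`) absent ⇒ NO WOUND OVER-WALK; ★★★★★ `ΩG.WE_eq_excursionWinding_of_over_killNW_pocketNW_column`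
— `K_N1 = killNW w` and `pocketNW w` absent with the far cell's column shut above up to a ceiling ⇒ NO WOUND OVER-WALK.
§2 ★★★★★ `ΩG.not_W2FreeOff_farW_of_wound_over_neColumnShut` — the edge `killNE.W` dead from either side (`rootNN ∨ killNE` absent) with
the column above shut ⇒ every wound over-walk is `w₂`-marked (doubles `rootN` through its `(π − θ)`-corners); ★★★★★
`ΩG.not_W1FreeOff_farW_of_wound_over_nwColumnShut` — `killNW ∨ farNWN` absent with the far column shut above ⇒ `w₁`-marked (`farNW`).
§3 Boxes for ANY further defects `S ∋ h` missing the far cell: `lawL_box_killNE_holeN_eastCol_not_wound_over`, `lawL_box_killNE_rootNN_eastCol_not_wound_over`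
(`h.1 + 3 = m`), `lawL_box_killNW_pocketNW_top_not_wound_over`, `lawL_box_rootNN_top_over_w2_killed`, `lawL_box_farNWN_top_over_w1_killed`
(`h.2 + 3 = n`).

Not in print; venture lane «pcv-sawmu», seat b-step0 gen 29 (FINDING-YB-KILL-FORCED-ZEROS §28).

References: A. Glazman, I. Manolescu, arXiv:1708.00395v3, §1 (Fig. 1, Fig. 2, remark after eq. (1)), §2.1, §4.2 (lattice symmetries),
Lemma 2.1 [GlazmanManolescu2019]; A. Glazman, Electron. Commun. Probab. 20 (2015) no. 86, Lemma 3.1, proof pp. 6–7 [Glazman2015WeightedSAW];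
R. Courant, H. Robbins, *What is Mathematics?* (1941/1958), Ch. V Appendix §2 (the even–odd rule) [CourantRobbins1958].
-/

noncomputable section

open Set Function Complex
open Literature.Topology.PlaneTopology

namespace Literature.Probability.RandomPlanarGeometry.SAW.YangBaxter

open Real
open Literature.Barriers.CriticalPhenomena.PlaquetteWalk (mirrorRowFace mirrorRowFace_mirrorRowFace)

namespace ΩG

variable {D : Set Face} {w : Face}

/-- The reflection in the root row on a cell, in coordinates. [cite: GlazmanManolescu2019, §4.2 (lattice symmetries)] -/
private theorem mirrorRowFace_mkN (w : Face) (x y : ℤ) : mirrorRowFace w.2 ((x, y) : Face) = (x, 2 * w.2 - y) := by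
  simp [mirrorRowFace]

/-! ## §1 The third-side law's northern twins: emptinesses of the over route -/

/-- ★★★★★ **`K_N2` ON THE EAST WALL AND `holeN` ABSENT ⇒ NO WOUND OVER-WALK** (row mirror of `…_of_under_killSE_holeS_eastWall`).
[cite: GlazmanManolescu2019, Lemma 2.1 (statement, "in the form given in [Gl]"), §4.2 (lattice symmetries)]
[cite: Glazman2015WeightedSAW, Lemma 3.1 (proof, pp. 6–7)] [cite: CourantRobbins1958, Ch. V Appendix §2 (the even–odd rule)] -/
theorem WE_eq_excursionWinding_of_over_killNE_holeN_eastWall (hh : holeFaceW w ∉ D) (hK : killNE w ∉ D)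
    (hHN : ((w.1 - 1, w.2 + 1) : Face) ∉ D) (heast : ∀ f : Face, f ∈ D → f.1 < w.1 + 2)
    (ω : ΩG D (w.side .W) (farW w)) (hr : RootedFace D (w.side .W) (farW w)) (h : ω.IsB2a)
    (hN : ω.2.firstSideG = .N) (θ : ℝ) :
    ω.WE (fun _ => θ) = excursionWinding θ ω.2.firstSideG (ω.z1 hr h) ω.1 := by
  by_contra hW
  have hr' := rootedFace_rowMirrorDom w hr
  have h' := ω.mirrorFar_isB2a hr h
  have hh' : holeFaceW w ∉ rowMirrorDom w D := by rwa [mem_rowMirrorDom, mirrorRowFace_holeFaceW]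
  have hK' : killSE w ∉ rowMirrorDom w D := by rwa [mem_rowMirrorDom, mirrorRowFace_killSE]
  have hHS' : ((w.1 - 1, w.2 - 1) : Face) ∉ rowMirrorDom w D := by
    rw [mem_rowMirrorDom, mirrorRowFace_mkN, show 2 * w.2 - (w.2 - 1) = w.2 + 1 by ring]; exact hHN
  have heast' : ∀ f : Face, f ∈ rowMirrorDom w D → f.1 < w.1 + 2 := by
    intro f hf; rw [mem_rowMirrorDom] at hf; have := heast _ hf; obtain ⟨x, y⟩ := f; rw [mirrorRowFace_mkN] at this; exact this
  have hS' : ω.mirrorFar.2.firstSideG = .S := by rw [mirrorFar_firstSideG, hN]; rfl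
  exact absurd (WE_eq_excursionWinding_of_under_killSE_holeS_eastWall hh' hK' hHS' heast' ω.mirrorFar hr' h' hS' _)
    (ω.mirrorFar_wound hr h hW)

/-- ★★★★★ **`K_N2` ON THE EAST WALL AND `rootNN = (w.1, w.2 + 2)` ABSENT ⇒ NO WOUND OVER-WALK** (row mirror of `…_killSE_rootSS_eastWall`).
[cite: GlazmanManolescu2019, Lemma 2.1 (statement, "in the form given in [Gl]"), §4.2 (lattice symmetries)]
[cite: Glazman2015WeightedSAW, Lemma 3.1 (proof, pp. 6–7)] [cite: CourantRobbins1958, Ch. V Appendix §2 (the even–odd rule)] -/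
theorem WE_eq_excursionWinding_of_over_killNE_rootNN_eastWall (hh : holeFaceW w ∉ D) (hK : killNE w ∉ D)
    (hNN : ((w.1, w.2 + 2) : Face) ∉ D) (heast : ∀ f : Face, f ∈ D → f.1 < w.1 + 2)
    (ω : ΩG D (w.side .W) (farW w)) (hr : RootedFace D (w.side .W) (farW w)) (h : ω.IsB2a)
    (hN : ω.2.firstSideG = .N) (θ : ℝ) :
    ω.WE (fun _ => θ) = excursionWinding θ ω.2.firstSideG (ω.z1 hr h) ω.1 := by
  by_contra hW
  have hr' := rootedFace_rowMirrorDom w hr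
  have h' := ω.mirrorFar_isB2a hr h
  have hh' : holeFaceW w ∉ rowMirrorDom w D := by rwa [mem_rowMirrorDom, mirrorRowFace_holeFaceW]
  have hK' : killSE w ∉ rowMirrorDom w D := by rwa [mem_rowMirrorDom, mirrorRowFace_killSE]
  have hSS' : ((w.1, w.2 - 2) : Face) ∉ rowMirrorDom w D := by
    rw [mem_rowMirrorDom, mirrorRowFace_mkN, show 2 * w.2 - (w.2 - 2) = w.2 + 2 by ring]; exact hNN
  have heast' : ∀ f : Face, f ∈ rowMirrorDom w D → f.1 < w.1 + 2 := by
    intro f hf; rw [mem_rowMirrorDom] at hf; have := heast _ hf; obtain ⟨x, y⟩ := f; rw [mirrorRowFace_mkN] at this; exact this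
  have hS' : ω.mirrorFar.2.firstSideG = .S := by rw [mirrorFar_firstSideG, hN]; rfl
  exact absurd (WE_eq_excursionWinding_of_under_killSE_rootSS_eastWall hh' hK' hSS' heast' ω.mirrorFar hr' h' hS' _)
    (ω.mirrorFar_wound hr h hW)

/-- ★★★★★ **`K_N1` AND THE NORTH-WESTERN POCKET ABSENT WITH THE FAR CELL'S COLUMN SHUT ABOVE ⇒ NO WOUND OVER-WALK** (row mirror of
`…_of_under_killSW_pocketSW_column`): hole, `killNW w = (w.1 − 3, w.2 + 2)` and `pocketNW w = (w.1 − 3, w.2 + 1)` absent; a ceiling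
`Y ≥ w.2 + 2` with no face above it; the west sides of column `w.1 − 2` dead in the rows `w.2 + 3, …, Y`.
[cite: GlazmanManolescu2019, Lemma 2.1 (statement, "in the form given in [Gl]"), §4.2 (lattice symmetries)]
[cite: Glazman2015WeightedSAW, Lemma 3.1 (proof, pp. 6–7)] [cite: CourantRobbins1958, Ch. V Appendix §2 (the even–odd rule)] -/
theorem WE_eq_excursionWinding_of_over_killNW_pocketNW_column (hh : holeFaceW w ∉ D) (hK : killNW w ∉ D)
    (hP : pocketNW w ∉ D) {Y : ℤ} (hY : w.2 + 2 ≤ Y)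
    (hcol : ∀ y : ℤ, w.2 + 3 ≤ y → y ≤ Y → ((w.1 - 3, y) : Face) ∉ D ∨ ((w.1 - 2, y) : Face) ∉ D)
    (hceil : ∀ f : Face, f ∈ D → f.2 ≤ Y)
    (ω : ΩG D (w.side .W) (farW w)) (hr : RootedFace D (w.side .W) (farW w)) (h : ω.IsB2a)
    (hN : ω.2.firstSideG = .N) (θ : ℝ) :
    ω.WE (fun _ => θ) = excursionWinding θ ω.2.firstSideG (ω.z1 hr h) ω.1 := by
  by_contra hW
  have hr' := rootedFace_rowMirrorDom w hr
  have h' := ω.mirrorFar_isB2a hr h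
  have hh' : holeFaceW w ∉ rowMirrorDom w D := by rwa [mem_rowMirrorDom, mirrorRowFace_holeFaceW]
  have hK' : killSW w ∉ rowMirrorDom w D := by rwa [mem_rowMirrorDom, mirrorRowFace_killSW]
  have hP' : pocketSW w ∉ rowMirrorDom w D := by
    rw [mem_rowMirrorDom]
    have e : mirrorRowFace w.2 (pocketSW w) = pocketNW w := by obtain ⟨a, b⟩ := w; simp [mirrorRowFace, pocketSW, pocketNW]; ring
    rw [e]; exact hP
  have hcol' : ∀ y : ℤ, 2 * w.2 - Y ≤ y → y ≤ w.2 - 3 →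
      ((w.1 - 3, y) : Face) ∉ rowMirrorDom w D ∨ ((w.1 - 2, y) : Face) ∉ rowMirrorDom w D := by
    intro y hy1 hy2
    rw [mem_rowMirrorDom, mem_rowMirrorDom, mirrorRowFace_mkN, mirrorRowFace_mkN]
    exact hcol (2 * w.2 - y) (by omega) (by omega)
  have hfloor' : ∀ f : Face, f ∈ rowMirrorDom w D → 2 * w.2 - Y ≤ f.2 := by
    intro f hf; rw [mem_rowMirrorDom] at hf; have := hceil _ hf; obtain ⟨x, y⟩ := f
    rw [mirrorRowFace_mkN] at this; simp only at this ⊢; omega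
  have hS' : ω.mirrorFar.2.firstSideG = .S := by rw [mirrorFar_firstSideG, hN]; rfl
  exact absurd (WE_eq_excursionWinding_of_under_killSW_pocketSW_column hh' hK' hP' (Y := 2 * w.2 - Y) (by omega) hcol' hfloor'
    ω.mirrorFar hr' h' hS' _) (ω.mirrorFar_wound hr h hW)

/-! ## §2 The edge form's northern twins: markings of the over route -/

/-- ★★★★★ **`killNE.W` DEAD FROM EITHER SIDE (`rootNN ∨ K_N2` absent) WITH THE COLUMN ABOVE SHUT ⇒ every wound OVER-walk is `w₂`-MARKED**
(doubles `rootN` through its `(π − θ)`-corners; row mirror of `not_W1FreeOff_farW_of_wound_under_seColumnShut`).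
[cite: GlazmanManolescu2019, §1 (the paragraph of Fig. 2), §4.2 (lattice symmetries), Lemma 2.1]
[cite: Glazman2015WeightedSAW, Lemma 3.1 (proof, pp. 6–7)] [cite: CourantRobbins1958, Ch. V Appendix §2 (the even–odd rule)] -/
theorem not_W2FreeOff_farW_of_wound_over_neColumnShut (hh : holeFaceW w ∉ D)
    (hKW : ((w.1, w.2 + 2) : Face) ∉ D ∨ killNE w ∉ D) {Y : ℤ} (hY : w.2 + 2 ≤ Y)
    (hcol : ∀ y : ℤ, w.2 + 3 ≤ y → y ≤ Y → ((w.1, y) : Face) ∉ D ∨ ((w.1 + 1, y) : Face) ∉ D)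
    (hceil : ∀ f : Face, f ∈ D → f.2 ≤ Y)
    (ω : ΩG D (w.side .W) (farW w)) (hr : RootedFace D (w.side .W) (farW w)) (h : ω.IsB2a)
    (hN : ω.2.firstSideG = .N) {θ : ℝ}
    (hW : ω.WE (fun _ => θ) ≠ excursionWinding θ ω.2.firstSideG (ω.z1 hr h) ω.1) : ¬ω.2.W2FreeOff (farW w) := by
  have hr' := rootedFace_rowMirrorDom w hr
  have h' := ω.mirrorFar_isB2a hr h
  have hh' : holeFaceW w ∉ rowMirrorDom w D := by rwa [mem_rowMirrorDom, mirrorRowFace_holeFaceW]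
  have hKW' : ((w.1, w.2 - 2) : Face) ∉ rowMirrorDom w D ∨ killSE w ∉ rowMirrorDom w D := by
    rcases hKW with hk | hk
    · left; rw [mem_rowMirrorDom, mirrorRowFace_mkN, show 2 * w.2 - (w.2 - 2) = w.2 + 2 by ring]; exact hk
    · right; rwa [mem_rowMirrorDom, mirrorRowFace_killSE]
  have hcol' : ∀ y : ℤ, 2 * w.2 - Y ≤ y → y ≤ w.2 - 3 →
      ((w.1, y) : Face) ∉ rowMirrorDom w D ∨ ((w.1 + 1, y) : Face) ∉ rowMirrorDom w D := by
    intro y hy1 hy2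
    rw [mem_rowMirrorDom, mem_rowMirrorDom, mirrorRowFace_mkN, mirrorRowFace_mkN]
    exact hcol (2 * w.2 - y) (by omega) (by omega)
  have hfloor' : ∀ f : Face, f ∈ rowMirrorDom w D → 2 * w.2 - Y ≤ f.2 := by
    intro f hf; rw [mem_rowMirrorDom] at hf; have := hceil _ hf; obtain ⟨x, y⟩ := f
    rw [mirrorRowFace_mkN] at this; simp only at this ⊢; omega
  have hS' : ω.mirrorFar.2.firstSideG = .S := by rw [mirrorFar_firstSideG, hN]; rfl
  have hkill := not_W1FreeOff_farW_of_wound_under_seColumnShut hh' hKW' (Y := 2 * w.2 - Y) (by omega) hcol' hfloor'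
    ω.mirrorFar hr' h' hS' (ω.mirrorFar_wound hr h hW)
  intro hfree
  apply hkill
  intro g hg hgf hk
  have hk2 := ω.kindsIn_eq_coCorner_of_mirrorFar_corner hk
  have hmem : mirrorRowFace w.2 g ∈ ω.2.facesVisited := by
    by_contra hn
    rw [YBWalk.kindsIn_eq_nil hn] at hk2
    exact List.cons_ne_nil _ _ hk2.symm
  have hne : mirrorRowFace w.2 g ≠ farW w := by
    intro e
    apply hgf
    have e' := congrArg (mirrorRowFace w.2) e
    rw [mirrorRowFace_mirrorRowFace, mirrorRowFace_farW] at e'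
    exact e'
  exact hfree _ hmem hne hk2

/-- ★★★★★ **`killNW.E` DEAD FROM EITHER SIDE (`K_N1 ∨ farNWN` absent) WITH THE FAR CELL'S COLUMN SHUT ABOVE ⇒ every wound OVER-walk is
`w₁`-MARKED** (doubles `farNW` through its `θ`-corners; row mirror of `not_W2FreeOff_farW_of_wound_under_swColumnShut`).
[cite: GlazmanManolescu2019, §1 (remark after eq. (1)), §4.2 (lattice symmetries), Lemma 2.1]
[cite: Glazman2015WeightedSAW, Lemma 3.1 (proof, pp. 6–7)] [cite: CourantRobbins1958, Ch. V Appendix §2 (the even–odd rule)] -/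
theorem not_W1FreeOff_farW_of_wound_over_nwColumnShut (hh : holeFaceW w ∉ D)
    (hKE : killNW w ∉ D ∨ ((w.1 - 2, w.2 + 2) : Face) ∉ D) {Y : ℤ} (hY : w.2 + 2 ≤ Y)
    (hcol : ∀ y : ℤ, w.2 + 3 ≤ y → y ≤ Y → ((w.1 - 3, y) : Face) ∉ D ∨ ((w.1 - 2, y) : Face) ∉ D)
    (hceil : ∀ f : Face, f ∈ D → f.2 ≤ Y)
    (ω : ΩG D (w.side .W) (farW w)) (hr : RootedFace D (w.side .W) (farW w)) (h : ω.IsB2a)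
    (hN : ω.2.firstSideG = .N) {θ : ℝ}
    (hW : ω.WE (fun _ => θ) ≠ excursionWinding θ ω.2.firstSideG (ω.z1 hr h) ω.1) : ¬ω.2.W1FreeOff (farW w) := by
  have hr' := rootedFace_rowMirrorDom w hr
  have h' := ω.mirrorFar_isB2a hr h
  have hh' : holeFaceW w ∉ rowMirrorDom w D := by rwa [mem_rowMirrorDom, mirrorRowFace_holeFaceW]
  have hKE' : killSW w ∉ rowMirrorDom w D ∨ ((w.1 - 2, w.2 - 2) : Face) ∉ rowMirrorDom w D := by
    rcases hKE with hk | hk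
    · left; rwa [mem_rowMirrorDom, mirrorRowFace_killSW]
    · right; rw [mem_rowMirrorDom, mirrorRowFace_mkN, show 2 * w.2 - (w.2 - 2) = w.2 + 2 by ring]; exact hk
  have hcol' : ∀ y : ℤ, 2 * w.2 - Y ≤ y → y ≤ w.2 - 3 →
      ((w.1 - 3, y) : Face) ∉ rowMirrorDom w D ∨ ((w.1 - 2, y) : Face) ∉ rowMirrorDom w D := by
    intro y hy1 hy2
    rw [mem_rowMirrorDom, mem_rowMirrorDom, mirrorRowFace_mkN, mirrorRowFace_mkN]
    exact hcol (2 * w.2 - y) (by omega) (by omega)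
  have hfloor' : ∀ f : Face, f ∈ rowMirrorDom w D → 2 * w.2 - Y ≤ f.2 := by
    intro f hf; rw [mem_rowMirrorDom] at hf; have := hceil _ hf; obtain ⟨x, y⟩ := f
    rw [mirrorRowFace_mkN] at this; simp only at this ⊢; omega
  have hS' : ω.mirrorFar.2.firstSideG = .S := by rw [mirrorFar_firstSideG, hN]; rfl
  have hkill := not_W2FreeOff_farW_of_wound_under_swColumnShut hh' hKE' (Y := 2 * w.2 - Y) (by omega) hcol' hfloor'
    ω.mirrorFar hr' h' hS' (ω.mirrorFar_wound hr h hW)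
  intro hfree
  apply hkill
  intro g hg hgf hk
  have hk2 := ω.kindsIn_eq_corner_of_mirrorFar_coCorner hk
  have hmem : mirrorRowFace w.2 g ∈ ω.2.facesVisited := by
    by_contra hn
    rw [YBWalk.kindsIn_eq_nil hn] at hk2
    exact List.cons_ne_nil _ _ hk2.symm
  have hne : mirrorRowFace w.2 g ≠ farW w := by
    intro e
    apply hgf
    have e' := congrArg (mirrorRowFace w.2) e
    rw [mirrorRowFace_mirrorRowFace, mirrorRowFace_farW] at e'
    exact e'
  exact hfree _ hmem hne hk2

end ΩG

end Literature.Probability.RandomPlanarGeometry.SAW.YangBaxter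

namespace Literature.Barriers.CriticalPhenomena.PlaquetteWalk

open Literature.Probability.RandomPlanarGeometry.SAW.YangBaxter
open Real Complex

/-! ## §3 Boxes -/

section Boxes

variable {m n : ℕ} {S : List Face} {h : Face}

/-- ★★★★★ **`h.1 + 3 = m`, ANY FURTHER DEFECTS: `K_N2 = (h.1 + 2, h.2 + 2)` AND `holeN = (h.1, h.2 + 1)` REMOVED ⇒ NO WOUND OVER-WALK.**
[cite: GlazmanManolescu2019, Lemma 2.1 (statement, "in the form given in [Gl]"), §2.1, §4.2]
[cite: Glazman2015WeightedSAW, Lemma 3.1 (proof, pp. 6–7)] [cite: CourantRobbins1958, Ch. V Appendix §2 (the even–odd rule)] -/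
theorem lawL_box_killNE_holeN_eastCol_not_wound_over (hW : 1 ≤ h.1) (hE3 : h.1 + 3 = m) (hS0 : 0 ≤ h.2) (hN : h.2 + 1 ≤ n)
    (hh : h ∈ S) (hfS : ((h.1 - 1, h.2) : Face) ∉ S) (hcK : ((h.1 + 2, h.2 + 2) : Face) ∈ S)
    (hcH : ((h.1, h.2 + 1) : Face) ∈ S)
    (ω : ΩG (dom (boxMinus m n S)) (Face.side (h.1 + 1, h.2) .W) (farW (h.1 + 1, h.2))) (hb : ω.IsB2a)
    (hN' : ω.2.firstSideG = .N) (θ : ℝ) :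
    ω.WE (fun _ => θ) = excursionWinding θ ω.2.firstSideG
      (ω.z1 (rootedFace_hroot_boxMinus_of_mem (farW_hroot_mem_boxMinus_of_not_mem hW (by omega) hS0 hN hfS) hh) hb)
      ω.1 := by
  refine ΩG.WE_eq_excursionWinding_of_over_killNE_holeN_eastWall ?_ ?_ ?_ (fun f hf => ?_) ω _ hb hN' θ
  · rw [holeFaceW_hroot]; exact not_mem_dom_boxMinus_of_mem hh
  · have e : killNE ((h.1 + 1, h.2) : Face) = (h.1 + 2, h.2 + 2) := Prod.ext (by simp only [killNE]; ring) rfl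
    rw [e]; exact not_mem_dom_boxMinus_of_mem hcK
  · have e : ((h.1 + 1 - 1, h.2 + 1) : Face) = (h.1, h.2 + 1) := Prod.ext (by simp only; ring) rfl
    rw [e]; exact not_mem_dom_boxMinus_of_mem hcH
  · have := (mem_dom_boxMinus.1 hf).1.2.1
    simp only; omega

/-- ★★★★★ **`h.1 + 3 = m`, ANY FURTHER DEFECTS: `K_N2` AND `rootNN = (h.1 + 1, h.2 + 2)` REMOVED ⇒ NO WOUND OVER-WALK.**
[cite: GlazmanManolescu2019, Lemma 2.1 (statement, "in the form given in [Gl]"), §2.1, §4.2]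
[cite: Glazman2015WeightedSAW, Lemma 3.1 (proof, pp. 6–7)] [cite: CourantRobbins1958, Ch. V Appendix §2 (the even–odd rule)] -/
theorem lawL_box_killNE_rootNN_eastCol_not_wound_over (hW : 1 ≤ h.1) (hE3 : h.1 + 3 = m) (hS0 : 0 ≤ h.2) (hN : h.2 + 1 ≤ n)
    (hh : h ∈ S) (hfS : ((h.1 - 1, h.2) : Face) ∉ S) (hcK : ((h.1 + 2, h.2 + 2) : Face) ∈ S)
    (hcR : ((h.1 + 1, h.2 + 2) : Face) ∈ S)
    (ω : ΩG (dom (boxMinus m n S)) (Face.side (h.1 + 1, h.2) .W) (farW (h.1 + 1, h.2))) (hb : ω.IsB2a)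
    (hN' : ω.2.firstSideG = .N) (θ : ℝ) :
    ω.WE (fun _ => θ) = excursionWinding θ ω.2.firstSideG
      (ω.z1 (rootedFace_hroot_boxMinus_of_mem (farW_hroot_mem_boxMinus_of_not_mem hW (by omega) hS0 hN hfS) hh) hb)
      ω.1 := by
  refine ΩG.WE_eq_excursionWinding_of_over_killNE_rootNN_eastWall ?_ ?_ (not_mem_dom_boxMinus_of_mem hcR) (fun f hf => ?_)
    ω _ hb hN' θ
  · rw [holeFaceW_hroot]; exact not_mem_dom_boxMinus_of_mem hh
  · have e : killNE ((h.1 + 1, h.2) : Face) = (h.1 + 2, h.2 + 2) := Prod.ext (by simp only [killNE]; ring) rfl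
    rw [e]; exact not_mem_dom_boxMinus_of_mem hcK
  · have := (mem_dom_boxMinus.1 hf).1.2.1
    simp only; omega

/-- ★★★★★ **TOP WALL TWO ROWS ABOVE THE HOLE (`h.2 + 3 = n`), ANY FURTHER DEFECTS: `K_N1 = (h.1 − 2, n − 1)` AND THE NORTH-WESTERN POCKET
`(h.1 − 2, n − 2)` REMOVED ⇒ NO WOUND OVER-WALK.** [cite: GlazmanManolescu2019, Lemma 2.1 (statement, "in the form given in [Gl]"), §2.1, §4.2]
[cite: Glazman2015WeightedSAW, Lemma 3.1 (proof, pp. 6–7)] [cite: CourantRobbins1958, Ch. V Appendix §2 (the even–odd rule)] -/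
theorem lawL_box_killNW_pocketNW_top_not_wound_over (hW : 2 ≤ h.1) (hE : h.1 ≤ m) (hS0 : 0 ≤ h.2) (hN3 : h.2 + 3 = n)
    (hh : h ∈ S) (hfS : ((h.1 - 1, h.2) : Face) ∉ S) (hcK : ((h.1 - 2, h.2 + 2) : Face) ∈ S)
    (hcP : ((h.1 - 2, h.2 + 1) : Face) ∈ S)
    (ω : ΩG (dom (boxMinus m n S)) (Face.side (h.1 + 1, h.2) .W) (farW (h.1 + 1, h.2))) (hb : ω.IsB2a)
    (hN' : ω.2.firstSideG = .N) (θ : ℝ) :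
    ω.WE (fun _ => θ) = excursionWinding θ ω.2.firstSideG
      (ω.z1 (rootedFace_hroot_boxMinus_of_mem (farW_hroot_mem_boxMinus_of_not_mem (by omega) hE hS0 (by omega) hfS)
        hh) hb) ω.1 := by
  refine ΩG.WE_eq_excursionWinding_of_over_killNW_pocketNW_column ?_ ?_ ?_ (Y := (n : ℤ) - 1) (by omega)
    (fun y hy hy' => by omega) (fun f hf => ?_) ω _ hb hN' θ
  · rw [holeFaceW_hroot]; exact not_mem_dom_boxMinus_of_mem hh
  · have e : killNW ((h.1 + 1, h.2) : Face) = (h.1 - 2, h.2 + 2) := Prod.ext (by simp only [killNW]; ring) rfl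
    rw [e]; exact not_mem_dom_boxMinus_of_mem hcK
  · have e : pocketNW ((h.1 + 1, h.2) : Face) = (h.1 - 2, h.2 + 1) := Prod.ext (by simp only [pocketNW]; ring) rfl
    rw [e]; exact not_mem_dom_boxMinus_of_mem hcP
  · have := (mem_dom_boxMinus.1 hf).1.2.2.2; omega

/-- ★★★★★ **`h.2 + 3 = n`, ANY FURTHER DEFECTS: `rootNN = (h.1 + 1, n − 1)` REMOVED ⇒ THE OVER ROUTE IS `w₂`-KILLED** (the top shut-row cell).
[cite: GlazmanManolescu2019, §1 (the paragraph of Fig. 2), Lemma 2.1, §4.2]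
[cite: Glazman2015WeightedSAW, Lemma 3.1 (proof, pp. 6–7)] [cite: CourantRobbins1958, Ch. V Appendix §2 (the even–odd rule)] -/
theorem lawL_box_rootNN_top_over_w2_killed (hW : 1 ≤ h.1) (hE : h.1 ≤ m) (hS0 : 0 ≤ h.2) (hN3 : h.2 + 3 = n)
    (hh : h ∈ S) (hfS : ((h.1 - 1, h.2) : Face) ∉ S) (hcR : ((h.1 + 1, h.2 + 2) : Face) ∈ S) (θ : ℝ) :
    ∀ (ω : ΩG (dom (boxMinus m n S)) (Face.side (h.1 + 1, h.2) .W) (farW (h.1 + 1, h.2))) (hb : ω.IsB2a),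
      ω.2.firstSideG = .N →
      ω.WE (fun _ => θ) ≠ excursionWinding θ ω.2.firstSideG
        (ω.z1 (rootedFace_hroot_boxMinus_of_mem (farW_hroot_mem_boxMinus_of_not_mem hW hE hS0 (by omega) hfS) hh)
          hb) ω.1 →
      ¬ω.2.W2FreeOff (farW (h.1 + 1, h.2)) := by
  intro ω hb hN' hW'
  have hhD : holeFaceW ((h.1 + 1, h.2) : Face) ∉ dom (boxMinus m n S) := by
    rw [holeFaceW_hroot]; exact not_mem_dom_boxMinus_of_mem hh
  exact ΩG.not_W2FreeOff_farW_of_wound_over_neColumnShut hhD (Or.inl (not_mem_dom_boxMinus_of_mem hcR)) (Y := (n : ℤ) - 1)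
    (by omega) (fun y hy hy' => by omega) (fun f hf => by have := (mem_dom_boxMinus.1 hf).1.2.2.2; omega) ω _ hb hN' hW'

/-- ★★★★★ **`h.2 + 3 = n`, ANY FURTHER DEFECTS: `farNWN = (h.1 − 1, n − 1)` REMOVED ⇒ THE OVER ROUTE IS `w₁`-KILLED** (the top shut-row cell
above the far cell's northern neighbour). [cite: GlazmanManolescu2019, §1 (remark after eq. (1)), Lemma 2.1, §4.2]
[cite: Glazman2015WeightedSAW, Lemma 3.1 (proof, pp. 6–7)] [cite: CourantRobbins1958, Ch. V Appendix §2 (the even–odd rule)] -/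
theorem lawL_box_farNWN_top_over_w1_killed (hW : 1 ≤ h.1) (hE : h.1 ≤ m) (hS0 : 0 ≤ h.2) (hN3 : h.2 + 3 = n)
    (hh : h ∈ S) (hfS : ((h.1 - 1, h.2) : Face) ∉ S) (hcF : ((h.1 - 1, h.2 + 2) : Face) ∈ S) (θ : ℝ) :
    ∀ (ω : ΩG (dom (boxMinus m n S)) (Face.side (h.1 + 1, h.2) .W) (farW (h.1 + 1, h.2))) (hb : ω.IsB2a),
      ω.2.firstSideG = .N →
      ω.WE (fun _ => θ) ≠ excursionWinding θ ω.2.firstSideG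
        (ω.z1 (rootedFace_hroot_boxMinus_of_mem (farW_hroot_mem_boxMinus_of_not_mem hW hE hS0 (by omega) hfS) hh)
          hb) ω.1 →
      ¬ω.2.W1FreeOff (farW (h.1 + 1, h.2)) := by
  intro ω hb hN' hW'
  have hhD : holeFaceW ((h.1 + 1, h.2) : Face) ∉ dom (boxMinus m n S) := by
    rw [holeFaceW_hroot]; exact not_mem_dom_boxMinus_of_mem hh
  refine ΩG.not_W1FreeOff_farW_of_wound_over_nwColumnShut hhD (Or.inr ?_) (Y := (n : ℤ) - 1)
    (by omega) (fun y hy hy' => by omega) (fun f hf => by have := (mem_dom_boxMinus.1 hf).1.2.2.2; omega) ω _ hb hN' hW'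
  have e : ((((h.1 + 1, h.2) : Face).1 - 2, ((h.1 + 1, h.2) : Face).2 + 2) : Face) = (h.1 - 1, h.2 + 2) :=
    Prod.ext (by simp only; ring) rfl
  rw [e]; exact not_mem_dom_boxMinus_of_mem hcF

end Boxes

end Literature.Barriers.CriticalPhenomena.PlaquetteWalk
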